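import Mathlib.Algebra.CharP.Two
import Literature.InformationTheory.Coding.SourcePolarizationStepBit
import Literature.InformationTheory.Coding.SourcePolarizationChainRule
import HarnessLib

/-!
# One step of source polarization, VII: the recursion of the leakage profile

Theorem-only companion of `Literature/InformationTheory/Coding/SourcePolarizationStep.lean`.
For a packaged binary source with functional side information `S : Src` and its synthetic sources
`S.minus`, `S.plus`:

* `leak_succ_lo`, `leak_succ_hi` — THE ONE-STEP RECURSION of the leakage profile in natural index
  order: `leak S.g (s+1) j = leak S⁻.g s j` and `leak S.g (s+1) (2^s + j) = leak S⁺.g s j` for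
  `j < 2^s` [Arıkan 2010, §III with Arıkan 2009, §VII]: under the pairing of copy `c` with copy
  `2^s + c` (`cfgMinus`, `cfgPlus`, bijections of the sample spaces) the conditioning data
  `(U_j, U_{<j}, Y^{2t})` at level `s + 1` and the conditioning data of the synthetic source at
  level `s` are recodings of each other (`ctx_ker_minus`, `ctx_ker_plus`; for the plus step the
  earlier bits `U_{<2^s}` determine the minus-bits `U` by injectivity of the polar transform), so
  the entropies agree (`mapEntropy_univ_eq_of_ker_eq`, `mapEntropy_univ_comp_equiv`);
* `leak_zero` — at block length `1`, `leak g 0 j = condEnt g = H(B | Y)`;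
* `Src.H_step` — the one-step conservation law `H(S⁻) + H(S⁺) = 2 H(S)` (the chain rule
  `ChainRule_holds` at `s = 1` through the recursion) [Arıkan 2010, Prop. 1: `H(U₁|Y₁Y₂) +
  H(U₂|Y₁Y₂U₁) = 2H(X|Y)`].

## References

* E. Arıkan, *Source polarization*, Proc. IEEE ISIT 2010, §III, Prop. 1.  bib `Arikan2010`.
* E. Arıkan, *Channel polarization…*, IEEE Trans. IT 55 (2009), §VII.  bib `Arikan2009`.
-/

noncomputable section

namespace Literature.InformationTheory.Coding.Polar

open Finset Literature.InformationTheory.Entropy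

/-! ### Order of low and high indices -/

/-- Low indices compare as their labels. [folklore] -/
theorem loIdx_lt_loIdx {s : ℕ} {a b : Fin (2 ^ s)} : loIdx s a < loIdx s b ↔ a < b := by
  rw [Fin.lt_def, Fin.lt_def, loIdx_val, loIdx_val]

/-- High indices compare as their labels. [folklore] -/
theorem hiIdx_lt_hiIdx {s : ℕ} {a b : Fin (2 ^ s)} : hiIdx s a < hiIdx s b ↔ a < b := by
  rw [Fin.lt_def, Fin.lt_def, hiIdx_val, hiIdx_val]
  omega

/-- Every low index is below every high index. [folklore] -/
theorem loIdx_lt_hiIdx {s : ℕ} (a b : Fin (2 ^ s)) : loIdx s a < hiIdx s b := by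
  rw [Fin.lt_def, loIdx_val, hiIdx_val]
  omega

/-! ### The target bit and the side information under the pairings -/

variable {m : ℕ} {β : Type} [DecidableEq β]

omit [DecidableEq β] in
/-- The polarized bit `U_j` at level `s+1` is the bit `U_j` of the minus source at level `s`.
[cite: Arikan2009, §VII (recursive structure of G_N)] -/
theorem tgt_cfgMinus (s : ℕ) (j : Fin (2 ^ s)) (X : Cfg (s + 1) m) :
    tgt s j (cfgMinus s X) = tgt (s + 1) (loIdx s j) X := by
  unfold tgt
  rw [polarBit_succ_lo]
  rfl

omit [DecidableEq β] in
/-- The polarized bit `U_{2^s + j}` at level `s+1` is the bit `U_j` of the plus source at level `s`.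
[cite: Arikan2009, §VII (recursive structure of G_N)] -/
theorem tgt_cfgPlus (s : ℕ) (j : Fin (2 ^ s)) (X : Cfg (s + 1) m) :
    tgt s j (cfgPlus s X) = tgt (s + 1) (hiIdx s j) X := by
  unfold tgt
  rw [polarBit_succ_hi]
  rfl

/-- The side information of `S⁻` on the paired configuration is the pair of side informations.
[folklore] -/
theorem minus_g_cfgMinus (S : Src) (s : ℕ) (X : Cfg (s + 1) S.m) (c : Fin (2 ^ s)) :
    S.minus.g (cfgMinus s X c).1 (cfgMinus s X c).2 =
      (S.g (X (loIdx s c)).1 (X (loIdx s c)).2, S.g (X (hiIdx s c)).1 (X (hiIdx s c)).2) := by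
  simp only [cfgMinus_apply, Src.minus_g_apply, Equiv.apply_symm_apply]
  rw [add_assoc, CharTwo.add_self_eq_zero, add_zero]

/-- The side information of `S⁺` on the paired configuration is `(U_c, Y_c, Y_{2^s+c})`.
[folklore] -/
theorem plus_g_cfgPlus (S : Src) (s : ℕ) (X : Cfg (s + 1) S.m) (c : Fin (2 ^ s)) :
    S.plus.g (cfgPlus s X c).1 (cfgPlus s X c).2 =
      ((X (loIdx s c)).1 + (X (hiIdx s c)).1, S.g (X (loIdx s c)).1 (X (loIdx s c)).2,
        S.g (X (hiIdx s c)).1 (X (hiIdx s c)).2) := by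
  simp only [cfgPlus_apply, Src.plus_g_apply, Equiv.apply_symm_apply]

/-! ### Equal kernels -/

/-- **Minus step, conditioning data**: `(U_{<j}, Y^{2t})` at level `s+1` (`j < 2^s`) and the
conditioning data of index `j` of `S⁻` at level `s` determine each other. [cite: Arikan2010, §III (H(U₁ | Y₁Y₂) is the minus source)] -/
theorem ctx_ker_minus (S : Src) (s : ℕ) (j : Fin (2 ^ s)) (X X' : Cfg (s + 1) S.m) :
    ctx S.g (s + 1) (loIdx s j) X = ctx S.g (s + 1) (loIdx s j) X' ↔
      ctx S.minus.g s j (cfgMinus s X) = ctx S.minus.g s j (cfgMinus s X') := by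
  unfold ctx
  rw [Prod.mk.injEq, Prod.mk.injEq, masked_eq_iff, masked_eq_iff]
  have hY : ((fun c => S.g (X c).1 (X c).2) = fun c => S.g (X' c).1 (X' c).2) ↔
      ((fun c => S.minus.g (cfgMinus s X c).1 (cfgMinus s X c).2) =
        fun c => S.minus.g (cfgMinus s X' c).1 (cfgMinus s X' c).2) := by
    rw [eq_iff_lo_hi s]
    constructor
    · intro h
      funext c
      rw [minus_g_cfgMinus, minus_g_cfgMinus]
      exact congr_fun h c
    · intro h
      funext c
      have h1 := congr_fun h c
      rw [minus_g_cfgMinus, minus_g_cfgMinus] at h1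
      exact h1
  have hA : (∀ j' : Fin (2 ^ (s + 1)), j' < loIdx s j →
      polarBit (s + 1) j' (fun c => (X c).1) = polarBit (s + 1) j' (fun c => (X' c).1)) ↔
      ∀ j'' : Fin (2 ^ s), j'' < j →
        polarBit s j'' (fun c => (cfgMinus s X c).1) = polarBit s j'' (fun c => (cfgMinus s X' c).1) := by
    constructor
    · intro h j'' hj''
      have h1 := h (loIdx s j'') (loIdx_lt_loIdx.2 hj'')
      rw [polarBit_succ_lo, polarBit_succ_lo] at h1
      exact h1
    · intro h j' hj'
      have hlt : j'.val < 2 ^ s := lt_trans (Fin.lt_def.1 hj') j.isLt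
      have hj'eq : j' = loIdx s ⟨j'.val, hlt⟩ := Fin.ext rfl
      rw [hj'eq] at hj' ⊢
      rw [polarBit_succ_lo, polarBit_succ_lo]
      exact h ⟨j'.val, hlt⟩ (loIdx_lt_loIdx.1 hj')
  rw [hA, hY]

/-- **Plus step, conditioning data**: `(U_{<2^s+j}, Y^{2t})` at level `s+1` (`j < 2^s`) and the
conditioning data of index `j` of `S⁺` at level `s` determine each other (the bits `U_{<2^s}`
determine the minus-bits `U` by injectivity of the polar transform, and conversely).
[cite: Arikan2010, §III (H(U₂ | Y₁Y₂U₁) is the plus source)] -/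
theorem ctx_ker_plus (S : Src) (s : ℕ) (j : Fin (2 ^ s)) (X X' : Cfg (s + 1) S.m) :
    ctx S.g (s + 1) (hiIdx s j) X = ctx S.g (s + 1) (hiIdx s j) X' ↔
      ctx S.plus.g s j (cfgPlus s X) = ctx S.plus.g s j (cfgPlus s X') := by
  unfold ctx
  rw [Prod.mk.injEq, Prod.mk.injEq, masked_eq_iff, masked_eq_iff]
  have hYp : ((fun c => S.plus.g (cfgPlus s X c).1 (cfgPlus s X c).2) =
      fun c => S.plus.g (cfgPlus s X' c).1 (cfgPlus s X' c).2) ↔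
      ((fun c => (X (loIdx s c)).1 + (X (hiIdx s c)).1) =
          fun c => (X' (loIdx s c)).1 + (X' (hiIdx s c)).1) ∧
        ((fun c => (S.g (X (loIdx s c)).1 (X (loIdx s c)).2, S.g (X (hiIdx s c)).1 (X (hiIdx s c)).2)) =
          fun c => (S.g (X' (loIdx s c)).1 (X' (loIdx s c)).2,
            S.g (X' (hiIdx s c)).1 (X' (hiIdx s c)).2)) := by
    constructor
    · intro h
      have h1 : ∀ c, (X (loIdx s c)).1 + (X (hiIdx s c)).1 = (X' (loIdx s c)).1 + (X' (hiIdx s c)).1 ∧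
          (S.g (X (loIdx s c)).1 (X (loIdx s c)).2, S.g (X (hiIdx s c)).1 (X (hiIdx s c)).2) =
            (S.g (X' (loIdx s c)).1 (X' (loIdx s c)).2, S.g (X' (hiIdx s c)).1 (X' (hiIdx s c)).2) := by
        intro c
        have h2 := congr_fun h c
        rw [plus_g_cfgPlus, plus_g_cfgPlus] at h2
        exact Prod.mk.inj h2
      exact ⟨funext fun c => (h1 c).1, funext fun c => (h1 c).2⟩
    · rintro ⟨hu, hY2⟩
      funext c
      rw [plus_g_cfgPlus, plus_g_cfgPlus, congr_fun hu c]
      exact congrArg _ (congr_fun hY2 c)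
  rw [hYp, eq_iff_lo_hi s (fun c => S.g (X c).1 (X c).2)]
  constructor
  · rintro ⟨hAm, hYm⟩
    have hu : (fun c => (X (loIdx s c)).1 + (X (hiIdx s c)).1) =
        fun c => (X' (loIdx s c)).1 + (X' (hiIdx s c)).1 := by
      apply polarBit_injective s
      funext j''
      have h1 := hAm (loIdx s j'') (loIdx_lt_hiIdx j'' j)
      rwa [polarBit_succ_lo, polarBit_succ_lo] at h1
    refine ⟨fun j'' hj'' => ?_, hu, hYm⟩
    have h1 := hAm (hiIdx s j'') (hiIdx_lt_hiIdx.2 hj'')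
    rwa [polarBit_succ_hi, polarBit_succ_hi] at h1
  · rintro ⟨hAp, hu, hY2⟩
    refine ⟨fun j' hj' => ?_, hY2⟩
    rcases eq_loIdx_or_eq_hiIdx s j' with ⟨c, rfl⟩ | ⟨c, rfl⟩
    · rw [polarBit_succ_lo, polarBit_succ_lo, hu]
    · rw [polarBit_succ_hi, polarBit_succ_hi]
      exact hAp c (hiIdx_lt_hiIdx.1 hj')

/-! ### The recursion -/

/-- **Recursion of the leakage profile, low half**: for `j < 2^s`,
`H(U_j | U_{<j}, Y^{2t})` for `2t = 2^(s+1)` copies of `S` equals `H(U_j | U_{<j}, Y'^{t})` for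
`t` copies of `S⁻`. [cite: Arikan2010, §III (recursive computation of H(U_i | U^{i-1}, Y^N))] -/
theorem leak_succ_lo (S : Src) (s : ℕ) (j : Fin (2 ^ s)) :
    leak S.g (s + 1) (loIdx s j) = leak S.minus.g s j := by
  set e : Cfg (s + 1) S.m ≃ Cfg s S.minus.m :=
    Equiv.ofBijective (β := Cfg s S.minus.m) (cfgMinus s) (cfgMinus_bijective s) with he
  unfold leak
  rw [← mapEntropy_univ_comp_equiv e (fun Y => (tgt s j Y, ctx S.minus.g s j Y)),
    ← mapEntropy_univ_comp_equiv e (ctx S.minus.g s j)]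
  congr 1
  · refine mapEntropy_univ_eq_of_ker_eq fun X X' => ?_
    constructor
    · intro h
      obtain ⟨ht, hc⟩ := Prod.mk.inj h
      exact Prod.ext ((tgt_cfgMinus s j X).trans (ht.trans (tgt_cfgMinus s j X').symm))
        ((ctx_ker_minus S s j X X').1 hc)
    · intro h
      obtain ⟨ht, hc⟩ := Prod.mk.inj h
      exact Prod.ext ((tgt_cfgMinus s j X).symm.trans (ht.trans (tgt_cfgMinus s j X')))
        ((ctx_ker_minus S s j X X').2 hc)
  · refine mapEntropy_univ_eq_of_ker_eq fun X X' => ?_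
    exact ctx_ker_minus S s j X X'

/-- **Recursion of the leakage profile, high half**: for `j < 2^s`,
`H(U_{2^s+j} | U_{<2^s+j}, Y^{2t})` for `2t = 2^(s+1)` copies of `S` equals `H(U_j | U_{<j}, Y'^{t})`
for `t` copies of `S⁺`. [cite: Arikan2010, §III (recursive computation of H(U_i | U^{i-1}, Y^N))] -/
theorem leak_succ_hi (S : Src) (s : ℕ) (j : Fin (2 ^ s)) :
    leak S.g (s + 1) (hiIdx s j) = leak S.plus.g s j := by
  set e : Cfg (s + 1) S.m ≃ Cfg s S.plus.m :=
    Equiv.ofBijective (β := Cfg s S.plus.m) (cfgPlus s) (cfgPlus_bijective s) with he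
  unfold leak
  rw [← mapEntropy_univ_comp_equiv e (fun Y => (tgt s j Y, ctx S.plus.g s j Y)),
    ← mapEntropy_univ_comp_equiv e (ctx S.plus.g s j)]
  congr 1
  · refine mapEntropy_univ_eq_of_ker_eq fun X X' => ?_
    constructor
    · intro h
      obtain ⟨ht, hc⟩ := Prod.mk.inj h
      exact Prod.ext ((tgt_cfgPlus s j X).trans (ht.trans (tgt_cfgPlus s j X').symm))
        ((ctx_ker_plus S s j X X').1 hc)
    · intro h
      obtain ⟨ht, hc⟩ := Prod.mk.inj h
      exact Prod.ext ((tgt_cfgPlus s j X).symm.trans (ht.trans (tgt_cfgPlus s j X')))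
        ((ctx_ker_plus S s j X X').2 hc)
  · refine mapEntropy_univ_eq_of_ker_eq fun X X' => ?_
    exact ctx_ker_plus S s j X X'

/-- The only index at block length `2^0 = 1`. [folklore] -/
theorem fin_two_pow_zero_eq (i : Fin (2 ^ 0)) : i = ⟨0, Nat.one_pos⟩ :=
  Fin.ext (by have h := i.isLt; simp only [pow_zero] at h; omega)

/-- **Block length one**: `leak g 0 j = H(B | Y) = condEnt g`. [cite: Arikan2010, §III (N = 1)] -/
theorem leak_zero (g : ZMod 2 → (Fin m → ZMod 2) → β) (j : Fin (2 ^ 0)) : leak g 0 j = condEnt g := by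
  obtain rfl := fin_two_pow_zero_eq j
  have hfull := mapEntropy_masked_full g 0
  have hzero := mapEntropy_masked_zero g 0
  rw [show ((2 : ℝ) ^ (0 : ℕ)) = 1 from pow_zero _, one_mul] at hfull hzero
  unfold leak condEnt
  rw [← hfull, ← hzero]
  congr 1
  refine mapEntropy_univ_eq_of_ker_eq fun X X' => ?_
  simp only [tgt, ctx, Prod.mk.injEq, funext_iff]
  constructor
  · rintro ⟨ht, -, hY⟩
    refine ⟨fun i => ?_, hY⟩
    obtain rfl := fin_two_pow_zero_eq i
    rw [if_pos (by norm_num), if_pos (by norm_num)]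
    exact ht
  · rintro ⟨hA, hY⟩
    refine ⟨?_, fun i => ?_, hY⟩
    · have h1 := hA ⟨0, Nat.one_pos⟩
      rwa [if_pos (by norm_num), if_pos (by norm_num)] at h1
    · rw [if_neg (fun h => (Nat.not_lt_zero _) (Fin.lt_def.1 h)),
        if_neg (fun h => (Nat.not_lt_zero _) (Fin.lt_def.1 h))]

/-- **One-step conservation law `H(S⁻) + H(S⁺) = 2 H(S)`**: the chain rule at block length `2`,
`H(U₀ | Y₀Y₁) + H(U₁ | U₀, Y₀Y₁) = 2 H(B | Y)`, read through the recursion.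
[cite: Arikan2010, Prop. 1 (H(U₁|Y₁²) + H(U₂|Y₁²U₁) = 2H(X|Y))] -/
theorem Src.H_step (S : Src) : S.minus.H + S.plus.H = 2 * S.H := by
  have hcr : ∑ j : Fin (2 ^ (0 + 1)), leak S.g (0 + 1) j = (2 : ℝ) ^ (0 + 1) * condEnt S.g :=
    ChainRule_holds S.m S.β S.g (0 + 1)
  have huniv : (univ : Finset (Fin (2 ^ 0))) = {⟨0, Nat.one_pos⟩} :=
    Finset.eq_singleton_iff_unique_mem.2 ⟨mem_univ _, fun i _ => fin_two_pow_zero_eq i⟩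
  rw [sum_univ_two_pow_succ 0, huniv, Finset.sum_singleton, Finset.sum_singleton, leak_succ_lo,
    leak_succ_hi, leak_zero, leak_zero] at hcr
  rw [Src.H_def, Src.H_def, Src.H_def, hcr]
  norm_num

end Literature.InformationTheory.Coding.Polar

end
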